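import Mathlib
import HarnessLib
import Summits.HubbardSuperconductivity.HubbardSuperconductivity.Theorems.KLProgrammeFermiSurfaceBandConstants
import Summits.HubbardSuperconductivity.HubbardSuperconductivity.Theorems.KLProgrammeKLRegimeEngineNearCoefficientRegime

/-!
# Route `KLProgramme` — ENGINE item stmt-HubbardSuperconductivity-20437, class #6 / (E5-F)ₙ producer, route (M), (R1) NUMERALS (part 1):
# the iso support count and the near coefficient with a CERTIFIED numeral — `C₀ ≤ 2^22`, `C_near = 8·C₀ ≤ 2^25`

Cell gate-hubbard-kl, seat hubbard-kl-k3c2-p2 (g12; owner-designate of M1 + M3 of route (M), pen (R59az)).  The landed M1 constants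
(`card_support_klIsoFamily_div_le_of_thresholds`, `near_coefficient_klIso_le_of_thresholds`) are existentially sealed; the fit of route (M) against the frozen `CF`
((R1), located risk «(c)-E5-FIT», evidence ROUTE-M-FIT.md) needs their closed forms as numerals.  This file re-derives both with the bound added to the `∃`
(same proofs verbatim + one numeric block): `C₀ = 64·K_f·C_ρ/(π³λ)` with `λ = 1/(2√2) ≥ 0.3535`, `K_f = 8π(4+4A)/λ + 1 ≤ 290` (`A ≤ 1/160`),
`C_ρ = 1 + (1 + 24π·s_max·Dt_min)/(Dt_min − 2A) ≤ 2200` (`s_max ≤ 25.2`, `Dt_min ≥ 0.332` at `(a,b) = (−6/5,−1/10)` by `klfs_cSmax_le` / `klfs_cDtmin_ge`, `A ≤ Dt_min/16`),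
`π³λ ≥ 10.95` ⇒ `C₀ ≤ 64·290·2200/10.95 < 2^22`:

* **`card_support_klIsoFamily_div_le_of_thresholds_bounded`** — `∃ C, 0 < C ∧ C ≤ 2^22 ∧ (the statement of `card_support_klIsoFamily_div_le_of_thresholds`)`;
* **`near_coefficient_klIso_le_of_thresholds_bounded`** — `∃ C, 0 < C ∧ C ≤ 2^25 ∧ (the statement of `near_coefficient_klIso_le_of_thresholds`)`.

Part 2 (…EngineIsoLineNumeral) carries the numeral through the regime shape and the assembly.  Everything is proved; no definitions; nothing about the model is asserted.
References: BGM 2006 §2.7 (2.69)–(2.71a) [cite: BenfattoGiulianiMastropietro2006].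
-/

noncomputable section

namespace Summit.HubbardSuperconductivity.HubbardSuperconductivity.Theorems.EngineV8

set_option linter.dupNamespace false -- summit = problem name (single-conjunct summit), D-0017

open Set Finset Literature.MathematicalPhysics.QuantumLattice Literature.MathematicalPhysics.QuantumLattice.BandSectorCounting
open Literature.MathematicalPhysics.QuantumLattice.FermiRG Literature.Probability.LatticeModels Literature.Analysis.SpecialFunctions
open Summit.HubbardSuperconductivity.HubbardSuperconductivity.Theorems.DispersionFlow
open Summit.HubbardSuperconductivity.HubbardSuperconductivity.Theorems.KLRegimeSplit
open Summit.HubbardSuperconductivity.HubbardSuperconductivity.Theorems.KLProgrammeLegKernels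
open Summit.HubbardSuperconductivity.HubbardSuperconductivity.Theorems.PerturbedFermiCurve
open Summit.HubbardSuperconductivity.HubbardSuperconductivity.Theorems.TorusFourierL2
open scoped Real

section Regime

open Classical

/-- **The numeral**: the closed form of the iso support-count constant at `(a,b) = (−6/5,−1/10)` is `≤ 2^22`
(`λ = 1/(2√2) ≥ 0.3535`, `K_f ≤ 290`, `s_max ≤ 25.2`, `Dt_min ≥ 0.332`, `C_ρ ≤ 2200`, `π³λ ≥ 10.95`). -/
theorem isoCountConst_le_two_pow (ha : (-4 : ℝ) < -(6 / 5)) (hab : (-(6 / 5) : ℝ) ≤ -(1 / 10)) (hb : (-(1 / 10) : ℝ) < 0) :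
    64 * (8 * π * (4 + 4 * (min (min ((bandBounds ha hab hb).Dtmin / 4) ((bandBounds ha hab hb).rhomin / 4)) (1 / 40) / 4)) / (1 / 2 / Real.sqrt 2) + 1) *
        (1 + (1 + 24 * π * (bandBounds ha hab hb).smax * (bandBounds ha hab hb).Dtmin) /
          ((bandBounds ha hab hb).Dtmin - 2 * (min (min ((bandBounds ha hab hb).Dtmin / 4) ((bandBounds ha hab hb).rhomin / 4)) (1 / 40) / 4))) /
      (π ^ 3 * (1 / 2 / Real.sqrt 2)) ≤ 2 ^ 22 := by
  set B : BandBounds (-(6 / 5)) (-(1 / 10)) := bandBounds ha hab hb with hBdef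
  set κ₀ : ℝ := min (min (B.Dtmin / 4) (B.rhomin / 4)) (1 / 40) with hκ₀
  set A : ℝ := κ₀ / 4 with hAdef
  set lam : ℝ := 1 / 2 / Real.sqrt 2 with hlam
  have hDt := B.Dtmin_pos
  have hrh := B.rhomin_pos
  have hsm := B.smax_pos
  have hπ := Real.pi_pos
  have hκ₀Dt : κ₀ ≤ B.Dtmin / 4 := (min_le_left _ _).trans (min_le_left _ _)
  have hκ₀40 : κ₀ ≤ 1 / 40 := min_le_right _ _
  have hκ₀pos : 0 < κ₀ := by rw [hκ₀]; exact lt_min (lt_min (by positivity) (by positivity)) (by norm_num)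
  have hA0 : 0 < A := by rw [hAdef]; positivity
  have hπhi : π ≤ 3.1416 := Real.pi_lt_d4.le
  have hπlo : (3.1415 : ℝ) ≤ π := Real.pi_gt_d4.le
  -- `λ ≥ 0.3535`
  have hs2 : Real.sqrt 2 ≤ 1.41422 := by
    rw [show (1.41422 : ℝ) = Real.sqrt (1.41422 ^ 2) by rw [Real.sqrt_sq (by norm_num)]]
    exact Real.sqrt_le_sqrt (by norm_num)
  have hs2pos : 0 < Real.sqrt 2 := Real.sqrt_pos.2 (by norm_num)
  have hlam0 : 0 < lam := by rw [hlam]; positivity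
  have hlamlo : (0.3535 : ℝ) ≤ lam := by
    rw [hlam, le_div_iff₀ hs2pos]
    calc (0.3535 : ℝ) * Real.sqrt 2 ≤ 0.3535 * 1.41422 := by gcongr
      _ ≤ 1 / 2 := by norm_num
  -- `K_f ≤ 290`
  have hA160 : A ≤ 1 / 160 := by rw [hAdef]; linarith
  have hKfle : 8 * π * (4 + 4 * A) / lam + 1 ≤ 290 := by
    have h1 : 8 * π * (4 + 4 * A) / lam ≤ 289 := by
      rw [div_le_iff₀ hlam0]
      have h2 : 8 * π * (4 + 4 * A) ≤ 8 * 3.1416 * (4 + 4 * (1 / 160)) := by gcongr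
      nlinarith [h2, hlamlo]
    linarith
  have hKf0 : 0 < 8 * π * (4 + 4 * A) / lam + 1 := by positivity
  -- `s_max ≤ 25.2`, `Dt_min ≥ 0.332`
  have hsq39 : (0.624 : ℝ) ≤ Real.sqrt (-(-(1 / 10) : ℝ) * (4 + -(1 / 10))) := by
    rw [show (-(-(1 / 10) : ℝ) * (4 + -(1 / 10))) = 0.624 ^ 2 + 0.000624 by norm_num]
    rw [show (0.624 : ℝ) = Real.sqrt (0.624 ^ 2) by rw [Real.sqrt_sq (by norm_num)]]
    exact Real.sqrt_le_sqrt (by norm_num)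
  have hsq28 : (1.673 : ℝ) ≤ Real.sqrt (-(6 / 5) + 4) := by
    rw [show (-(6 / 5) + 4 : ℝ) = 1.673 ^ 2 + 0.001071 by norm_num]
    rw [show (1.673 : ℝ) = Real.sqrt (1.673 ^ 2) by rw [Real.sqrt_sq (by norm_num)]]
    exact Real.sqrt_le_sqrt (by norm_num)
  have hsmaxE : B.smax = cSmax (-(1 / 10)) := by rw [hBdef]; rfl
  have hDtE : B.Dtmin = cDtmin (-(6 / 5)) (-(1 / 10)) := by rw [hBdef]; rfl
  have hsmax : B.smax ≤ 25.2 := by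
    have h := klfs_cSmax_le (b := -(1 / 10)) (by norm_num) (by norm_num)
    have h1 : 4 * π / Real.sqrt (-(-(1 / 10) : ℝ) * (4 + -(1 / 10))) ≤ 4 * 3.1416 / 0.624 :=
      calc 4 * π / Real.sqrt (-(-(1 / 10) : ℝ) * (4 + -(1 / 10))) ≤ 4 * π / 0.624 :=
            div_le_div_of_nonneg_left (by positivity) (by norm_num) hsq39
        _ ≤ 4 * 3.1416 / 0.624 := by gcongr
    have h2 : (4 * 3.1416 / 0.624 : ℝ) ≤ 20.2 := by norm_num
    rw [hsmaxE]
    linarith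
  have hDtlo : (0.332 : ℝ) ≤ B.Dtmin := by
    have h := klfs_cDtmin_ge (a := -(6 / 5)) (b := -(1 / 10)) (by norm_num) (by norm_num)
    have hprod : (0.624 * 1.673 : ℝ) ≤ Real.sqrt (-(-(1 / 10) : ℝ) * (4 + -(1 / 10))) * Real.sqrt (-(6 / 5) + 4) :=
      mul_le_mul hsq39 hsq28 (by norm_num) (Real.sqrt_nonneg _)
    have h1 : (0.624 * 1.673 / 3.1416 : ℝ) ≤ Real.sqrt (-(-(1 / 10) : ℝ) * (4 + -(1 / 10))) * Real.sqrt (-(6 / 5) + 4) / π :=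
      calc (0.624 * 1.673 / 3.1416 : ℝ) ≤ 0.624 * 1.673 / π := div_le_div_of_nonneg_left (by norm_num) hπ hπhi
        _ ≤ _ := div_le_div_of_nonneg_right hprod hπ.le
    have h2 : (0.332 : ℝ) ≤ 0.624 * 1.673 / 3.1416 := by norm_num
    rw [hDtE]
    linarith
  -- `C_ρ ≤ 2200`
  have hA16 : A ≤ B.Dtmin / 16 := by rw [hAdef]; linarith [hκ₀Dt]
  have hDtA : 0 < B.Dtmin - 2 * A := by linarith
  have hCρle : 1 + (1 + 24 * π * B.smax * B.Dtmin) / (B.Dtmin - 2 * A) ≤ 2200 := by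
    have h24 : 24 * π * B.smax ≤ 1901 := by
      calc 24 * π * B.smax ≤ 24 * 3.1416 * 25.2 := by gcongr
        _ ≤ 1901 := by norm_num
    have h24D : 24 * π * B.smax * B.Dtmin ≤ 1901 * B.Dtmin := mul_le_mul_of_nonneg_right h24 hDt.le
    have h1 : (1 + 24 * π * B.smax * B.Dtmin) / (B.Dtmin - 2 * A) ≤ 2199 := by
      rw [div_le_iff₀ hDtA]
      linarith
    linarith
  have hCρ0 : 0 < 1 + (1 + 24 * π * B.smax * B.Dtmin) / (B.Dtmin - 2 * A) := by positivity
  -- assemble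
  have hπ3 : (31.003 : ℝ) ≤ π ^ 3 := le_trans (by norm_num) (pow_le_pow_left₀ (by norm_num) hπlo 3)
  have hden : (10.95 : ℝ) ≤ π ^ 3 * lam := le_trans (by norm_num) (mul_le_mul hπ3 hlamlo (by norm_num) (by positivity))
  rw [div_le_iff₀ (by positivity)]
  calc 64 * (8 * π * (4 + 4 * A) / lam + 1) * (1 + (1 + 24 * π * B.smax * B.Dtmin) / (B.Dtmin - 2 * A))
      ≤ 64 * 290 * 2200 := by gcongr
    _ ≤ 2 ^ 22 * 10.95 := by norm_num
    _ ≤ 2 ^ 22 * (π ^ 3 * lam) := by gcongr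

/-- **The iso support count in the KL regime WITH THE NUMERAL `C ≤ 2^22`** (statement of `card_support_klIsoFamily_div_le_of_thresholds` otherwise verbatim). -/
theorem card_support_klIsoFamily_div_le_of_thresholds_bounded (ha : (-4 : ℝ) < -(6 / 5)) (hab : (-(6 / 5) : ℝ) ≤ -(1 / 10)) (hb : (-(1 / 10) : ℝ) < 0) :
    ∃ C : ℝ, 0 < C ∧ C ≤ 2 ^ 22 ∧ ∀ (R : RenConsts), (∀ j, 0 ≤ R.Gfr j) →
      ∀ (c U : ℝ), 0 < c →
      c ≤ min (min ((bandBounds ha hab hb).Dtmin / 4) ((bandBounds ha hab hb).rhomin / 4)) (1 / 40) / (12 * (R.Gfr 2 + 1)) → 0 < U →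
      U ≤ min 1 (min (min ((bandBounds ha hab hb).Dtmin / 4) ((bandBounds ha hab hb).rhomin / 4)) (1 / 40) / (24 * (R.Gfr 0 + R.Gfr 1 + 1))) →
      ∀ β : ℝ, klBetaMin ≤ β → β ≤ Real.exp (c / U ^ 2) → ∀ μ ∈ klWindowC, ∀ K : TrigPolyC4v, FrameOK R U (nScales β) μ K →
      ∀ (L M : ℕ) [NeZero L], β ^ 2 ≤ (L : ℝ) → ∀ m : ℕ, m ≤ nScales β → ∀ ω : Fin (sectorCount (2 * m)),
        ((((univ : Finset (FreqMomentum L M)).filter fun k => klIsoFamily L M β μ K klE0 m ω k ≠ 0).card : ℕ) : ℝ) / (β * (L : ℝ) ^ 2) ≤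
          C * klScale klE0 m ^ 3 := by
  classical
  set B : BandBounds (-(6 / 5)) (-(1 / 10)) := bandBounds ha hab hb with hBdef
  set κ₀ : ℝ := min (min (B.Dtmin / 4) (B.rhomin / 4)) (1 / 40) with hκ₀
  have hDt := B.Dtmin_pos
  have hrh := B.rhomin_pos
  have hκ₀pos : 0 < κ₀ := by rw [hκ₀]; exact lt_min (lt_min (by positivity) (by positivity)) (by norm_num)
  have hκ₀Dt : κ₀ ≤ B.Dtmin / 4 := (min_le_left _ _).trans (min_le_left _ _)
  have hκ₀40 : κ₀ ≤ 1 / 40 := min_le_right _ _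
  have he : (0 : ℝ) < klE0 := by norm_num [klE0]
  set A : ℝ := κ₀ / 4 with hAdef
  have hA0 : 0 < A := by rw [hAdef]; positivity
  have hDtA : 0 < B.Dtmin - 2 * A := by rw [hAdef]; linarith
  have hsm := B.smax_pos
  have hπ := Real.pi_pos
  have hπ3 := Real.pi_gt_three
  -- the gradient floor, the fibre constant, the cell-radius constant, the constant
  obtain ⟨lam, hlam⟩ : ∃ lam : ℝ, lam = (1 / 2 : ℝ) / Real.sqrt 2 := ⟨_, rfl⟩
  have hlam0 : 0 < lam := by rw [hlam]; positivity
  obtain ⟨Kf, hKf⟩ : ∃ Kf : ℝ, Kf = 8 * π * (4 + 4 * A) / lam + 1 := ⟨_, rfl⟩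
  have hKf0 : 0 < Kf := by rw [hKf]; positivity
  obtain ⟨Cρ, hCρ⟩ : ∃ Cρ : ℝ, Cρ = 1 + (1 + 24 * π * B.smax * B.Dtmin) / (B.Dtmin - 2 * A) := ⟨_, rfl⟩
  have hCρ0 : 0 < Cρ := by rw [hCρ]; positivity
  obtain ⟨C, hC⟩ : ∃ C : ℝ, C = 64 * Kf * Cρ / (π ^ 3 * lam) := ⟨_, rfl⟩
  have hC0 : 0 < C := by rw [hC]; positivity
  -- THE NUMERAL (`isoCountConst_le_two_pow`)
  have hCle : C ≤ 2 ^ 22 := by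
    rw [hC, hKf, hCρ, hlam, hAdef, hκ₀, hBdef]
    exact isoCountConst_le_two_pow ha hab hb
  refine ⟨C, hC0, hCle, ?_⟩
  intro R hR c U hc hcle hU hUle β hβmin hβc μ hμ K hK L M _ hLβ m hmN ω
  have hβ0 : 0 < β := pos_of_klBetaMin_le hβmin
  have hβ128 : 128 ≤ β := by simpa [klBetaMin] using hβmin
  have hL0 : (0 : ℝ) < L := lt_of_lt_of_le (by positivity) hLβ
  -- the frame's `C²` size is `≤ A = κ₀/4` (as in `gram_softShaped_bgmFat_sharp_of_thresholds`)
  have hlog : 1 ≤ Real.log 4 := by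
    have h4 : Real.exp 1 ≤ 4 := by have := Real.exp_one_lt_d9; norm_num at this; linarith
    calc (1 : ℝ) = Real.log (Real.exp 1) := (Real.log_exp 1).symm
      _ ≤ Real.log 4 := Real.log_le_log (Real.exp_pos 1) h4
  have hAK : ∀ p : Momentum, ∀ j ≤ 2, ‖iteratedFDeriv ℝ j (frameShift K) p‖ ≤ A := by
    intro p j hj
    refine (norm_iteratedFDeriv_frameShift_le_of_frameOK_regime hR hc.le hβmin hβc hK p hj).trans ?_
    have h0 := hR 0; have h1 := hR 1; have h2 := hR 2
    have hU1 : U ≤ 1 := hUle.trans (min_le_left _ _)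
    have hUk : U ≤ κ₀ / (24 * (R.Gfr 0 + R.Gfr 1 + 1)) := hUle.trans (min_le_right _ _)
    rw [abs_of_pos hU]
    have hU2 : U ^ 2 ≤ U := by nlinarith only [hU, hU1]
    have hA1 : 2 * R.Gfr 0 * U + 2 * R.Gfr 1 * U ^ 2 ≤ 2 * (R.Gfr 0 + R.Gfr 1 + 1) * U := by
      have := mul_le_mul_of_nonneg_left hU2 h1
      linarith only [this, hU.le]
    have hB1 : 2 * (R.Gfr 0 + R.Gfr 1 + 1) * U ≤ κ₀ / 12 := by
      have hpos : 0 < 24 * (R.Gfr 0 + R.Gfr 1 + 1) := by positivity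
      have := (le_div_iff₀ hpos).mp hUk
      linarith only [this]
    have hC1 : R.Gfr 2 * (c / Real.log 4) ≤ R.Gfr 2 * c := mul_le_mul_of_nonneg_left (div_le_self hc.le hlog) h2
    have hD1 : R.Gfr 2 * c ≤ κ₀ / 12 := by
      have hpos : 0 < 12 * (R.Gfr 2 + 1) := by positivity
      have := (le_div_iff₀ hpos).mp hcle
      linarith only [this, hc.le]
    rw [hAdef]; linarith only [hA1, hB1, hC1, hD1, hκ₀pos]
  -- the window margins
  have hμ' := hμ
  simp only [klWindowC, Set.mem_Icc] at hμ'
  have e1 : (-1.05 : ℝ) = -(21 / 20) := by norm_num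
  have e2 : (-0.15 : ℝ) = -(3 / 20) := by norm_num
  have hμlo : -(21 / 20 : ℝ) ≤ μ := by rw [← e1]; exact hμ'.1
  have hμhi : μ ≤ -(3 / 20 : ℝ) := by rw [← e2]; exact hμ'.2
  have he0 : klE0 = 1 / 32 := rfl
  have hlo : (-(6 / 5) : ℝ) ≤ μ - A - klE0 := by rw [he0, hAdef]; linarith only [hμlo, hκ₀40]
  have hhi : μ + A + klE0 ≤ -(1 / 10) := by rw [he0, hAdef]; linarith only [hμhi, hκ₀40]
  have hADt : 2 * A < B.Dtmin := by rw [hAdef]; linarith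
  -- the coordinate-gradient floor of the frame band on the shell `{|e_K| ≤ Λ_m}` (inside the tube `{|e_K| < 3/80}`)
  have hgradK : ∀ p : Fin 2 → ℝ, |frameLevel μ K (WithLp.toLp 2 p)| ≤ klScale klE0 m →
      lam ≤ |fderiv ℝ (fun q : Fin 2 → ℝ => frameLevel μ K (WithLp.toLp 2 q)) p (Pi.single 0 1)| ∨
        lam ≤ |fderiv ℝ (fun q : Fin 2 → ℝ => frameLevel μ K (WithLp.toLp 2 q)) p (Pi.single 1 1)| := by
    intro p hp
    have htube : |frameLevel μ K (WithLp.toLp 2 p)| < 3 / 80 :=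
      lt_of_le_of_lt (hp.trans (klScale_le_e0 he.le m)) (by norm_num [klE0])
    rw [hlam]
    exact coord_floor_of_le_norm_gradient ((EngineV8.contDiff_frameLevel μ K (n := 1)).differentiable one_ne_zero) (by norm_num) p
      (hK.1.le_norm_gradient _ htube)
  -- the scales: `π/β ≤ Λ_m ≤ e₀`, `π ≤ Λ_m L`
  set Λ : ℝ := klScale klE0 m with hΛdef
  have hΛ0 : 0 < Λ := klth_klScale_pos m
  have hanti : ∀ {a b : ℕ}, a ≤ b → klScale klE0 b ≤ klScale klE0 a := fun hab' => by
    unfold klScale; exact mul_le_mul_of_nonneg_left (inv_anti₀ (by positivity) (pow_le_pow_right₀ (by norm_num) hab')) he.le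
  have hΛβ : π / β ≤ Λ := (klth_pi_div_le_klScale_nScales hβmin).trans (hanti hmN)
  have hΛL : π ≤ Λ * L := by
    have h1 : π / β * β ^ 2 ≤ Λ * L := mul_le_mul hΛβ hLβ (by positivity) hΛ0.le
    have e : π / β * β ^ 2 = π * β := by field_simp
    rw [e] at h1
    nlinarith only [h1, hβ128, hπ]
  -- the cell radius in units of `Λ_m`
  set ρ₀ : ℝ := (klScale klE0 m + B.smax * B.Dtmin * (3 * sectorWidth (2 * m) / 4)) / (B.Dtmin - 2 * A) with hρ₀
  have hρΛ : ρ₀ + Λ = Cρ * Λ := by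
    rw [hρ₀, hCρ, sectorWidth_two_mul_eq_klScale, ← hΛdef]
    field_simp
    ring
  -- the three factor bounds (before the count enters the context: `positivity` must not scan it)
  have h1 : Λ / π + 3 / β ≤ 4 * Λ / π := by
    have : 3 / β ≤ 3 * Λ / π := by
      rw [div_le_div_iff₀ hβ0 hπ]
      have := (div_le_iff₀ hβ0).1 hΛβ
      nlinarith [this]
    have e : 4 * Λ / π = Λ / π + 3 * Λ / π := by ring
    linarith [this, e]
  have hρ00 : 0 ≤ ρ₀ := by
    rw [hρ₀]; have := sectorWidth_pos (2 * m); positivity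
  have h2 : 2 * (ρ₀ / π + 1 / L) ≤ 2 * (Cρ * Λ) / π := by
    have : 1 / (L : ℝ) ≤ Λ / π := by rw [div_le_div_iff₀ hL0 hπ]; linarith [hΛL]
    have e : 2 * (Cρ * Λ) / π = 2 * (ρ₀ / π + Λ / π) := by rw [← hρΛ]; ring
    linarith [this, e]
  have h3 : 4 * Λ / (π * lam) + 2 / L ≤ 8 * Λ / (π * lam) := by
    have hlam2 : lam ≤ 2 := by
      rw [hlam]
      have hs1 : 1 ≤ Real.sqrt 2 := by
        rw [show (1 : ℝ) = Real.sqrt 1 by simp]; exact Real.sqrt_le_sqrt (by norm_num)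
      rw [div_le_iff₀ (by positivity)]; linarith
    have : 2 / (L : ℝ) ≤ 4 * Λ / (π * lam) := by
      rw [div_le_div_iff₀ hL0 (by positivity)]
      have h1' : π * lam ≤ π * 2 := mul_le_mul_of_nonneg_left hlam2 hπ.le
      linarith [h1', hΛL]
    have e : 8 * Λ / (π * lam) = 4 * Λ / (π * lam) + 4 * Λ / (π * lam) := by ring
    linarith [this, e]
  have h20 : 0 ≤ 2 * (ρ₀ / π + 1 / L) := by positivity
  have h30 : 0 ≤ 4 * Λ / (π * lam) + 2 / L := by positivity
  have n1 : 0 ≤ Kf * (4 * Λ / (π * lam) + 2 / L) := mul_nonneg hKf0.le h30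
  have n2 : 0 ≤ 2 * (Cρ * Λ) / π := div_nonneg (mul_nonneg zero_le_two (mul_nonneg hCρ0.le hΛ0.le)) hπ.le
  have n3 : 0 ≤ 2 * (ρ₀ / π + 1 / L) * (Kf * (4 * Λ / (π * lam) + 2 / L)) := mul_nonneg h20 n1
  have n4 : 0 ≤ 4 * Λ / π := by positivity
  have hchain : (Λ / π + 3 / β) * (2 * (ρ₀ / π + 1 / L) * (Kf * (4 * Λ / (π * lam) + 2 / L))) ≤ C * Λ ^ 3 :=
    calc (Λ / π + 3 / β) * (2 * (ρ₀ / π + 1 / L) * (Kf * (4 * Λ / (π * lam) + 2 / L)))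
        ≤ (4 * Λ / π) * ((2 * (Cρ * Λ) / π) * (Kf * (8 * Λ / (π * lam)))) :=
          mul_le_mul h1 (mul_le_mul h2 (mul_le_mul_of_nonneg_left h3 hKf0.le) n1 n2) n3 n4
      _ = C * Λ ^ 3 := by rw [hC]; field_simp; ring
  -- the explicit count
  have h := card_support_klIsoFamily_div_le (L := L) (M := M) B hAK hADt he hlo hhi hβ0 m hlam0 hgradK ω
  rw [← hρ₀, ← hΛdef, ← hKf] at h
  exact h.trans hchain

/-- **The near coefficient in the KL regime WITH THE NUMERAL `C ≤ 2^25`** (statement of `near_coefficient_klIso_le_of_thresholds` otherwise verbatim). -/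
theorem near_coefficient_klIso_le_of_thresholds_bounded (ha : (-4 : ℝ) < -(6 / 5)) (hab : (-(6 / 5) : ℝ) ≤ -(1 / 10)) (hb : (-(1 / 10) : ℝ) < 0) :
    ∃ C : ℝ, 0 < C ∧ C ≤ 2 ^ 25 ∧ ∀ (R : RenConsts), (∀ j, 0 ≤ R.Gfr j) →
      ∀ (c U : ℝ), 0 < c →
      c ≤ min (min ((bandBounds ha hab hb).Dtmin / 4) ((bandBounds ha hab hb).rhomin / 4)) (1 / 40) / (12 * (R.Gfr 2 + 1)) → 0 < U →
      U ≤ min 1 (min (min ((bandBounds ha hab hb).Dtmin / 4) ((bandBounds ha hab hb).rhomin / 4)) (1 / 40) / (24 * (R.Gfr 0 + R.Gfr 1 + 1))) →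
      ∀ β : ℝ, klBetaMin ≤ β → β ≤ Real.exp (c / U ^ 2) → ∀ μ ∈ klWindowC, ∀ K : TrigPolyC4v, FrameOK R U (nScales β) μ K →
      ∀ (L M : ℕ) [NeZero L] [NeZero M], β ^ 2 ≤ (L : ℝ) → β ≤ (M : ℝ) → ∀ m : ℕ, m ≤ nScales β →
      ∀ (Ω : Fin 4 → SectorLeg (sectorCount (2 * m))) (x₁ : SpaceTimeIdx L M) (ρ : ℝ), 0 ≤ ρ →
        imagTimeWeight β M ^ 3 *
              ((((univ : Finset (SpaceTimeIdx L M)).filter fun y => spaceTimeDist L M β x₁ y < ρ / klScale klE0 m).card : ℕ) : ℝ) ^ 3 *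
            (∏ j : Fin 3, ((((univ : Finset (FreqMomentum L M)).filter fun q => klIsoFamily L M β μ K klE0 m (Ω j.succ).1.1 q ≠ 0).card : ℕ) : ℝ)) /
          (β * (L : ℝ) ^ 2) ^ 3 ≤
        (C * (ρ + klScale klE0 m) ^ 3) ^ 3 := by
  obtain ⟨C₀, hC₀, hC₀le, hcount⟩ := card_support_klIsoFamily_div_le_of_thresholds_bounded ha hab hb
  refine ⟨8 * C₀, by positivity, by linarith, ?_⟩
  intro R hR c U hc hcle hU hUle β hβmin hβc μ hμ K hK L M _ _ hLβ hβM m hmN Ω x₁ ρ hρ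
  have hβ0 : 0 < β := pos_of_klBetaMin_le hβmin
  have hL0 : (0 : ℝ) < L := Nat.cast_pos.2 (NeZero.pos L)
  have hM0 : (0 : ℝ) < M := Nat.cast_pos.2 (NeZero.pos M)
  set Λ : ℝ := klScale klE0 m with hΛdef
  have hΛ0 : 0 < Λ := klth_klScale_pos m
  set ε : ℝ := imagTimeWeight β M with hεdef
  have hε0 : 0 < ε := by rw [hεdef]; unfold imagTimeWeight; positivity
  have hε1 : ε ≤ 1 := by
    rw [hεdef, imagTimeWeight, div_le_one (by positivity)]; linarith
  set NR : ℝ := ((((univ : Finset (SpaceTimeIdx L M)).filter fun y => spaceTimeDist L M β x₁ y < ρ / Λ).card : ℕ) : ℝ) with hNR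
  set S : Fin 3 → ℝ := fun j => ((((univ : Finset (FreqMomentum L M)).filter fun q =>
    klIsoFamily L M β μ K klE0 m (Ω j.succ).1.1 q ≠ 0).card : ℕ) : ℝ) with hS
  have hS0 : ∀ j, 0 ≤ S j := fun j => Nat.cast_nonneg _
  have hNR0 : 0 ≤ NR := Nat.cast_nonneg _
  -- `ε·N_R ≤ (2R + 2ε)(2R + 2)² ≤ (2R + 2)³ = 8(ρ + Λ)³/Λ³`
  have hR0 : 0 ≤ ρ / Λ := div_nonneg hρ hΛ0.le
  have hεN : ε * NR ≤ 8 * (ρ + Λ) ^ 3 / Λ ^ 3 := by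
    have h1 := eps_mul_nearCount_le hε0 (card_spaceTimeBall_le_real hβ0 x₁ hR0)
    have h2 : (2 * (ρ / Λ) + 2 * ε) * (2 * (ρ / Λ) + 2) ^ 2 ≤ (2 * (ρ / Λ) + 2) ^ 3 := by
      have : 2 * (ρ / Λ) + 2 * ε ≤ 2 * (ρ / Λ) + 2 := by linarith
      calc (2 * (ρ / Λ) + 2 * ε) * (2 * (ρ / Λ) + 2) ^ 2 ≤ (2 * (ρ / Λ) + 2) * (2 * (ρ / Λ) + 2) ^ 2 :=
            mul_le_mul_of_nonneg_right this (by positivity)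
        _ = (2 * (ρ / Λ) + 2) ^ 3 := by ring
    have e : (2 * (ρ / Λ) + 2) ^ 3 = 8 * (ρ + Λ) ^ 3 / Λ ^ 3 := by
      field_simp
      ring
    exact h1.trans (h2.trans e.le)
  -- per leg: `ε·N_R·S_j/(βL²) ≤ 8(ρ+Λ)³/Λ³ · C₀ Λ³ = 8 C₀ (ρ+Λ)³`
  have hleg : ∀ j : Fin 3, ε * NR * S j / (β * (L : ℝ) ^ 2) ≤ 8 * C₀ * (ρ + Λ) ^ 3 := by
    intro j
    have hSj : S j / (β * (L : ℝ) ^ 2) ≤ C₀ * Λ ^ 3 := hcount R hR c U hc hcle hU hUle β hβmin hβc μ hμ K hK L M hLβ m hmN (Ω j.succ).1.1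
    have hSj0 : 0 ≤ S j / (β * (L : ℝ) ^ 2) := div_nonneg (hS0 j) (by positivity)
    calc ε * NR * S j / (β * (L : ℝ) ^ 2) = (ε * NR) * (S j / (β * (L : ℝ) ^ 2)) := by ring
      _ ≤ (8 * (ρ + Λ) ^ 3 / Λ ^ 3) * (C₀ * Λ ^ 3) := mul_le_mul hεN hSj hSj0 (by positivity)
      _ = 8 * C₀ * (ρ + Λ) ^ 3 := by field_simp
  have hleg0 : ∀ j : Fin 3, 0 ≤ ε * NR * S j / (β * (L : ℝ) ^ 2) := fun j => by
    have := hS0 j; positivity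
  rw [near_coefficient_eq_prod ε NR β L S]
  calc ∏ j : Fin 3, ε * NR * S j / (β * (L : ℝ) ^ 2) ≤ ∏ _j : Fin 3, 8 * C₀ * (ρ + Λ) ^ 3 :=
        prod_le_prod (fun j _ => hleg0 j) fun j _ => hleg j
    _ = (8 * C₀ * (ρ + Λ) ^ 3) ^ 3 := by rw [prod_const, card_univ, Fintype.card_fin]

end Regime

end Summit.HubbardSuperconductivity.HubbardSuperconductivity.Theorems.EngineV8

end
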